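import Mathlib
import Literature.Computability.AlgebraicComplexity.RealTauKnownCases
import Summits.ValiantsHypothesis.ValiantsHypothesis.Theorems.LacunarySymmetroidMatrixDescartesGramDual
import Summits.ValiantsHypothesis.ValiantsHypothesis.Theorems.LacunarySymmetroidMatrixDescartesGramDualSplitting
import Summits.ValiantsHypothesis.ValiantsHypothesis.Theorems.LacunarySymmetroidMatrixDescartesGramDualFrame
import Summits.ValiantsHypothesis.ValiantsHypothesis.Theorems.LacunarySymmetroidMatrixDescartesGramDualSigned

/-!
# `MatrixDescartes` (stmt-ValiantsHypothesis-18050) — Gram duality, part 5: the FRAME LAW for arbitrary letters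
# and «signed rank-one words of any size are small pencils»

HONEST FRAMING.  Cell `pub-symmetroid`, seat `val-sym-mdr-p2` (gen 19); helper file `--supports` the crux
`Theses.LacunarySymmetroid.MatrixDescartes` (OPEN), NO closure claim; companion of `…GramDualSigned` (signed Gram
duality `X^{ER}·det(X^eB + U diag(σX^δ) Uᵀ) = C(det B·∏σ)·X^{em+Σδ}·det(diag(σ⁻¹X^{E−δ}) + X^{E−e}·UᵀB⁻¹U)` for an
arbitrary non-degenerate base letter `B` and arbitrary signed columns).  Nothing here bears on the crux in its
window, on `stub_twoSided`, `DoorA26` / `DoorA34`, registers, or `VP ≠ VNP`.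

* **`card_posRoots_base_frame_le` (FRAME LAW, arbitrary letters).**  `det B ≠ 0`, signs `σⱼ ≠ 0`, columns
  pairwise `B⁻¹`-orthogonal ⇒ `Z₊(X^eB + U diag(σX^δ) Uᵀ) ≤ #{j : σⱼ · (uⱼᵀB⁻¹uⱼ) < 0}`: a column contributes
  at most one positive zero, and only when its sign DISAGREES with the sign of its `B⁻¹`-norm (against a positive
  definite base only negative columns count; against `B = diag(I_p, −I_q)` a positive column counts iff it is
  `B`-spacelike); `B⁻¹`-isotropic columns never count.  All sizes, all exponents on both sides of `e`.
* **`card_posRoots_signedRankOne_eq`.**  `X^eB + Σₖ cₖX^{dₖ}vₖvₖᵀ` (`cₖ ≠ 0` of any signs, ANY size `m`) has exactly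
  the positive zeros of the `κ × κ` pencil `diag(cₖ⁻¹X^{E−dₖ}) + X^{E−e}·(vₖᵀB⁻¹vₖ')_{kk'}`;
  `card_posRoots_signedRankOne_le_of_frame`: pairwise `B⁻¹`-orthogonal directions ⇒ `Z₊ ≤ #{k : cₖ·(vₖᵀB⁻¹vₖ) < 0}`.
Tools: `card_posRoots_signedBinomial_le_one`, `posRoots_signedBinomial_eq_empty` (Descartes for signed binomials).

[folklore] (Sylvester / Descartes for binomials; the lacunary-pencil reading is this seat's.)  Axioms `propext`,
`Classical.choice`, `Quot.sound`.
-/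

-- layout Summits/ValiantsHypothesis/ValiantsHypothesis forces the duplicated namespace component
set_option linter.dupNamespace false

namespace Summit.ValiantsHypothesis.ValiantsHypothesis.Theorems.LacunarySymmetroidMatrixDescartes

open Polynomial Matrix Finset
open scoped BigOperators

namespace GramDual

variable {ι ρ κ : Type*} [Fintype ι] [DecidableEq ι] [Fintype ρ] [DecidableEq ρ] [Fintype κ] [DecidableEq κ]

/-- the signed column part `U · diag(σⱼ X^{δⱼ}) · Uᵀ` (file-local notation, as in `…GramDualSigned`) -/
local notation3 (prettyPrint := false) "𝕊[" U ", " σ ", " δ "]" =>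
  ((U : Matrix _ _ ℝ).map Polynomial.C
      * Matrix.diagonal (fun j => Polynomial.C ((σ : _ → ℝ) j) * (Polynomial.X : Polynomial ℝ) ^ (δ j : ℕ))
      * ((U : Matrix _ _ ℝ).map Polynomial.C)ᵀ)

/-- the signed primal word (file-local notation, as in `…GramDualSigned`) -/
local notation3 (prettyPrint := false) "𝔽ₛ[" e ", " B ", " U ", " σ ", " δ "]" =>
  (((Polynomial.X : Polynomial ℝ) ^ (e : ℕ)) • (B : Matrix _ _ ℝ).map Polynomial.C + 𝕊[U, σ, δ])

/-- the signed dual word (file-local notation, as in `…GramDualSigned`) -/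
local notation3 (prettyPrint := false) "𝔻ₛ[" E ", " e ", " B ", " U ", " σ ", " δ "]" =>
  (Matrix.diagonal (fun j => Polynomial.C (((σ : _ → ℝ) j)⁻¹) * (Polynomial.X : Polynomial ℝ) ^ ((E : ℕ) - δ j))
    + ((Polynomial.X : Polynomial ℝ) ^ ((E : ℕ) - (e : ℕ))) •
      ((U : Matrix _ _ ℝ)ᵀ * (B : Matrix _ _ ℝ)⁻¹ * (U : Matrix _ _ ℝ)).map Polynomial.C)

/-! ## §4  Frame law for arbitrary letters -/

/-- A signed binomial `a X^p + b X^q` has at most one positive zero (the zero polynomial has none by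
convention). [folklore] -/
theorem card_posRoots_signedBinomial_le_one (p q : ℕ) (a b : ℝ) :
    ((Polynomial.C a * (Polynomial.X : Polynomial ℝ) ^ p + Polynomial.C b * (Polynomial.X : Polynomial ℝ) ^ q
        ).roots.toFinset.filter (fun t => 0 < t)).card ≤ 1 := by
  classical
  set g : Polynomial ℝ := Polynomial.C a * (Polynomial.X : Polynomial ℝ) ^ p
    + Polynomial.C b * (Polynomial.X : Polynomial ℝ) ^ q with hg
  by_cases h0 : g = 0
  · rw [h0, Polynomial.roots_zero, Multiset.toFinset_zero, Finset.filter_empty, Finset.card_empty]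
    exact Nat.zero_le _
  have hsupp : g.support ⊆ {p, q} := Polynomial.support_binomial_subset p q a b
  have hlt := Literature.Computability.AlgebraicComplexity.card_roots_toFinset_filter_pos_lt_card_support h0
  have hcard : g.support.card ≤ 2 := (Finset.card_le_card hsupp).trans (Finset.card_le_two)
  omega

/-- A signed binomial `a X^p + b X^q` with `a ≠ 0` and `0 ≤ a·b` has no positive zero. [folklore] -/
theorem posRoots_signedBinomial_eq_empty (p q : ℕ) {a b : ℝ} (ha : a ≠ 0) (hab : 0 ≤ a * b) :
    ((Polynomial.C a * (Polynomial.X : Polynomial ℝ) ^ p + Polynomial.C b * (Polynomial.X : Polynomial ℝ) ^ q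
        ).roots.toFinset.filter (fun t => 0 < t)) = ∅ := by
  rw [Finset.filter_eq_empty_iff]
  intro t ht hpos
  rw [Multiset.mem_toFinset, Polynomial.mem_roots', Polynomial.IsRoot.def] at ht
  obtain ⟨-, hev⟩ := ht
  rw [Polynomial.eval_add, Polynomial.eval_mul, Polynomial.eval_C, Polynomial.eval_pow, Polynomial.eval_X,
    Polynomial.eval_mul, Polynomial.eval_C, Polynomial.eval_pow, Polynomial.eval_X] at hev
  have h1 : 0 < t ^ p := pow_pos hpos _
  have h2 : 0 < t ^ q := pow_pos hpos _
  have h3 : a * a * t ^ p + a * b * t ^ q = 0 := by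
    have := congrArg (fun y => a * y) hev
    simp only [mul_add, mul_zero] at this
    linarith [this]
  have h4 : 0 < a * a * t ^ p := mul_pos (mul_self_pos.2 ha) h1
  have h5 : 0 ≤ a * b * t ^ q := mul_nonneg hab h2.le
  linarith

omit [Fintype ρ] in
/-- The signed dual of a `B⁻¹`-orthogonal frame is diagonal. [folklore] -/
theorem baseDual_eq_diagonal_of_frame (B : Matrix ι ι ℝ) (U : Matrix ι ρ ℝ) (σ : ρ → ℝ) (E e : ℕ) (δ : ρ → ℕ)
    (hoff : ∀ j j', j ≠ j' → (Uᵀ * B⁻¹ * U) j j' = 0) :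
    𝔻ₛ[E, e, B, U, σ, δ]
      = Matrix.diagonal fun j => Polynomial.C ((σ j)⁻¹) * (Polynomial.X : Polynomial ℝ) ^ (E - δ j)
          + Polynomial.C ((Uᵀ * B⁻¹ * U) j j) * (Polynomial.X : Polynomial ℝ) ^ (E - e) := by
  refine Matrix.ext fun j j' => ?_
  simp only [Matrix.add_apply, Matrix.diagonal_apply, Matrix.smul_apply, Matrix.map_apply, smul_eq_mul]
  by_cases h : j = j'
  · subst h
    simp only [if_true]
    ring
  · rw [if_neg h, if_neg h, hoff j j' h, map_zero, mul_zero, add_zero]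

/-- **FRAME LAW FOR ARBITRARY LETTERS.**  `det B ≠ 0`, signs `σⱼ ≠ 0`, columns pairwise `B⁻¹`-orthogonal
(`(UᵀB⁻¹U)_{jj'} = 0`, `j ≠ j'`): `Z₊(X^eB + U diag(σX^δ) Uᵀ) ≤ #{j : σⱼ · (uⱼᵀB⁻¹uⱼ) < 0}` — a column
contributes at most one positive zero, and only when its sign disagrees with the sign of its `B⁻¹`-norm; columns
that are `B⁻¹`-isotropic or whose sign agrees contribute none.  All sizes, all exponents. [folklore] -/
theorem card_posRoots_base_frame_le (B : Matrix ι ι ℝ) (hB : IsUnit B.det) (U : Matrix ι ρ ℝ) (σ : ρ → ℝ)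
    (hσ : ∀ j, σ j ≠ 0) (e : ℕ) (δ : ρ → ℕ) (hoff : ∀ j j', j ≠ j' → (Uᵀ * B⁻¹ * U) j j' = 0) :
    ((Matrix.det (𝔽ₛ[e, B, U, σ, δ])).roots.toFinset.filter (fun t => 0 < t)).card
      ≤ (Finset.univ.filter fun j => σ j * (Uᵀ * B⁻¹ * U) j j < 0).card := by
  classical
  obtain ⟨E, he, hδ⟩ := exists_bound e δ
  rw [posRoots_base_eq B hB U σ hσ e E δ he hδ, baseDual_eq_diagonal_of_frame B U σ E e δ hoff,
    Matrix.det_diagonal]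
  refine (card_posRoots_prod_le _ _).trans ?_
  rw [Finset.card_filter]
  refine Finset.sum_le_sum fun j _ => ?_
  by_cases hneg : σ j * (Uᵀ * B⁻¹ * U) j j < 0
  · rw [if_pos hneg]
    exact card_posRoots_signedBinomial_le_one _ _ _ _
  · rw [if_neg hneg, posRoots_signedBinomial_eq_empty _ _ (inv_ne_zero (hσ j)) ?_, Finset.card_empty]
    have h := not_lt.1 hneg
    have hσ2 : 0 < σ j * σ j := mul_self_pos.2 (hσ j)
    have : (σ j)⁻¹ * (Uᵀ * B⁻¹ * U) j j = (σ j * (Uᵀ * B⁻¹ * U) j j) / (σ j * σ j) := by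
      field_simp
    rw [this]
    exact div_nonneg h hσ2.le

/-! ## §5  Signed rank-one letters: words of any size are `κ × κ` pencils -/

omit [Fintype ι] [DecidableEq ι] in
/-- Signed rank-one letters `cₖ vₖvₖᵀ` are a signed column system on `κ`. [folklore] -/
theorem signedRankOne_eq (d : κ → ℕ) (c : κ → ℝ) (v : κ → ι → ℝ) :
    (∑ k, ((Polynomial.X : Polynomial ℝ) ^ d k) • (c k • Matrix.vecMulVec (v k) (v k)).map Polynomial.C)
      = 𝕊[(Matrix.of fun (i : ι) (k : κ) => v k i), c, d] := by
  refine Matrix.ext fun i i' => ?_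
  have hL : (∑ k, ((Polynomial.X : Polynomial ℝ) ^ d k) • (c k • Matrix.vecMulVec (v k) (v k)).map Polynomial.C)
        i i' = ∑ k, (Polynomial.X : Polynomial ℝ) ^ d k * (Polynomial.C (c k) *
          (Polynomial.C (v k i) * Polynomial.C (v k i'))) := by
    rw [Matrix.sum_apply]
    refine Finset.sum_congr rfl fun k _ => ?_
    rw [Matrix.smul_apply, Matrix.map_apply, Matrix.smul_apply, Matrix.vecMulVec_apply, smul_eq_mul,
      smul_eq_mul, map_mul, map_mul]
  have hR : (𝕊[(Matrix.of fun (i : ι) (k : κ) => v k i), c, d]) i i'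
      = ∑ k, Polynomial.C (v k i) * (Polynomial.C (c k) * (Polynomial.X : Polynomial ℝ) ^ d k)
          * Polynomial.C (v k i') := by
    rw [Matrix.mul_apply]
    refine Finset.sum_congr rfl fun k _ => ?_
    rw [Matrix.mul_diagonal, Matrix.transpose_apply, Matrix.map_apply, Matrix.map_apply, Matrix.of_apply,
      Matrix.of_apply]
  refine hL.trans (Eq.trans ?_ hR.symm)
  refine Finset.sum_congr rfl fun k _ => ?_
  ring

/-- **SIGNED RANK-ONE WORDS ARE SMALL PENCILS.**  `det B ≠ 0`, `cₖ ≠ 0` (any signs), `dₖ, e ≤ E`: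
`Z₊(X^eB + Σₖ cₖX^{dₖ} vₖvₖᵀ)` (any size) `= Z₊(diag(cₖ⁻¹X^{E−dₖ}) + X^{E−e}·(vₖᵀB⁻¹vₖ')_{kk'})` (size `card κ`).
[folklore] -/
theorem card_posRoots_signedRankOne_eq (B : Matrix ι ι ℝ) (hB : IsUnit B.det) (e E : ℕ) (d : κ → ℕ)
    (c : κ → ℝ) (hc : ∀ k, c k ≠ 0) (v : κ → ι → ℝ) (he : e ≤ E) (hd : ∀ k, d k ≤ E) :
    ((Matrix.det (((Polynomial.X : Polynomial ℝ) ^ e) • B.map Polynomial.C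
        + ∑ k, ((Polynomial.X : Polynomial ℝ) ^ d k) • (c k • Matrix.vecMulVec (v k) (v k)).map Polynomial.C)
        ).roots.toFinset.filter (fun t => 0 < t)).card
      = ((Matrix.det (Matrix.diagonal (fun k => Polynomial.C ((c k)⁻¹) * (Polynomial.X : Polynomial ℝ) ^ (E - d k))
          + ((Polynomial.X : Polynomial ℝ) ^ (E - e)) •
            (Matrix.of fun k k' : κ => v k ⬝ᵥ (B⁻¹ *ᵥ v k')).map Polynomial.C)
          ).roots.toFinset.filter (fun t => 0 < t)).card := by
  classical
  have hG : (Matrix.of fun (i : ι) (k : κ) => v k i)ᵀ * B⁻¹ * (Matrix.of fun (i : ι) (k : κ) => v k i)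
      = Matrix.of fun k k' : κ => v k ⬝ᵥ (B⁻¹ *ᵥ v k') := by
    refine Matrix.ext fun k k' => ?_
    rw [gram_rankOne, Matrix.of_apply]
  rw [signedRankOne_eq d c v, posRoots_base_eq B hB _ c hc e E d he hd, hG]

/-- **Frame law for signed rank-one letters**: pairwise `B⁻¹`-orthogonal directions ⇒
`Z₊(X^eB + Σₖ cₖX^{dₖ}vₖvₖᵀ) ≤ #{k : cₖ · (vₖᵀB⁻¹vₖ) < 0}`. [folklore] -/
theorem card_posRoots_signedRankOne_le_of_frame (B : Matrix ι ι ℝ) (hB : IsUnit B.det) (e : ℕ) (d : κ → ℕ)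
    (c : κ → ℝ) (hc : ∀ k, c k ≠ 0) (v : κ → ι → ℝ) (hoff : ∀ k k', k ≠ k' → v k ⬝ᵥ (B⁻¹ *ᵥ v k') = 0) :
    ((Matrix.det (((Polynomial.X : Polynomial ℝ) ^ e) • B.map Polynomial.C
        + ∑ k, ((Polynomial.X : Polynomial ℝ) ^ d k) • (c k • Matrix.vecMulVec (v k) (v k)).map Polynomial.C)
        ).roots.toFinset.filter (fun t => 0 < t)).card
      ≤ (Finset.univ.filter fun k => c k * (v k ⬝ᵥ (B⁻¹ *ᵥ v k)) < 0).card := by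
  classical
  rw [signedRankOne_eq d c v]
  refine (card_posRoots_base_frame_le B hB _ c hc e d fun k k' hkk' => ?_).trans (le_of_eq ?_)
  · rw [gram_rankOne]; exact hoff k k' hkk'
  · congr 1
    ext k
    simp only [Finset.mem_filter, Finset.mem_univ, true_and, gram_rankOne]

end GramDual

end Summit.ValiantsHypothesis.ValiantsHypothesis.Theorems.LacunarySymmetroidMatrixDescartes
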